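import Literature.Claims.NS.Karadzhov2026
import Literature.Analysis.FluidPDE.TorusNSBeltramiCurlForm
import HarnessLib

/-!
# C174 `Karadzhov2026` — SALVAGE (a) TRUE column: Lemma 69.2 (exact Beltrami cancellation) holds —
# `curl U = λU ⟹ (U·∇)U = ∇(½|U|²)` on `𝕋³`, by the tree's curl-form Lamb identity

Cell `ns-claims` (D-0090), lane ns-claims-salvage-p6 g4, records-grade (no token effect; no binder of the
skeleton's `claim_of_steps` is touched — `Step_L692` is the typist's RECORDED salvage candidate, off the
large-data path). The text of record (Zenodo 20095268 = OSF 2vhcp, 169 pp.) prints Lemma 69.2 p.109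
l.21–35: «If U ∈ B_{r,σ} is smooth, real-valued, divergence-free, and mean-zero, then P((U·∇)U) = 0», via
«(U·∇)U = ∇(½|U|²) − U × (curl U)» (365) and `curl U = σ r U`. The skeleton types it at the pointwise
grain: `Literature.Claims.NS.Karadzhov2026.Step_L692 : ∀ U λ, Torus.IsSmooth U → (∀ x, vort U x = λ • U x)
→ ∀ x, Torus.convect U U x = Torus.gradient (fun y => ½‖U y‖²) x`. This is a THEOREM of the tree:
`Literature.Analysis.FluidPDE.Torus.convect_self_eq_gradient_of_curl_eq_smul` (Majda–Bertozzi Prop. 2.10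
/ Pizzocchero 2021 fn. 8), stated with the pointwise curl `BDSV.curl`; the skeleton's `Lietz2026.vort` is the
same three-component formula (`vort_eq_bdsvCurl`, by components). Hence `step_L692_holds`.

WHAT THIS IS NOT: not a claim about NS regularity or blow-up; not a claim about any author beyond the
typed locator.
-/

set_option linter.dupNamespace false

noncomputable section

namespace Summit.NavierStokesRegularity.NavierStokesRegularity.Theorems.Karadzhov2026

open Literature.Analysis.FluidPDE Literature.Analysis.FunctionSpaces Literature.Claims.NS

/-- The skeleton's vorticity `Lietz2026.vort` (components `∂₁v₂ − ∂₂v₁, ∂₂v₀ − ∂₀v₂, ∂₀v₁ − ∂₁v₀` in the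
tree's `Torus.partialDeriv`) IS the tree's pointwise curl `BDSV.curl`.
[cite: MajdaBertozziCUP2002, §2.3.2 Def. 2.1 eq. (2.38)] -/
theorem vort_eq_bdsvCurl (v : UnitAddTorus (Fin 3) → EuclideanSpace ℝ (Fin 3)) (x : UnitAddTorus (Fin 3)) :
    Lietz2026.vort v x = BDSV.curl v x := by
  ext i
  fin_cases i
  · simp [Lietz2026.vort, BDSV.curl_apply_zero]
  · simp [Lietz2026.vort, BDSV.curl_apply_one]
  · simp [Lietz2026.vort, BDSV.curl_apply_two]

/-- **Lemma 69.2 (exact Beltrami cancellation) as typed HOLDS**: for smooth `U` on `𝕋³` with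
`curl U = λU` pointwise, `(U·∇)U = ∇(½|U|²)` (so its Leray projection vanishes). Discharged by the
tree's curl-form Lamb identity `Torus.convect_self_eq_gradient_of_curl_eq_smul`.
[cite: Karadzhov2026, Lemma 69.2 (363)–(365) p.109 l.4–35] [cite: MajdaBertozziCUP2002, §2.3.2 Prop. 2.10] -/
theorem step_L692_holds : Karadzhov2026.Step_L692 := by
  intro U lam hU hcurl x
  have hc : ∀ y, BDSV.curl U y = lam • U y := fun y => by
    rw [← vort_eq_bdsvCurl]; exact hcurl y
  have h := Torus.convect_self_eq_gradient_of_curl_eq_smul hU hc x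
  have hfun : (fun y => (1 / 2 : ℝ) * ‖U y‖ ^ 2) = fun y => ‖U y‖ ^ 2 / 2 := by
    funext y; ring
  rw [hfun]
  exact h

end Summit.NavierStokesRegularity.NavierStokesRegularity.Theorems.Karadzhov2026

end
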